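/-
Copyright: statement-level skeleton of a published paper (lit-balaban cell, reader/typer r15). No proof claims beyond
what the kernel checks below.
-/
import Mathlib

/-!
# BIJ85 — T. Bałaban, J. Imbrie, A. Jaffe, *Renormalization of the Higgs model: minimizers, propagators and the
stability of mean field theory*, CMP **97** (1985) 299–329, Sect. 2: the cell averages (2.6)/(2.9), (2.16)–(2.18),
(2.20)–(2.24) and the gauge covariance (2.8)

statement-level skeleton of published theorems with citation tags; proofs where landed; nothing here is a claim about
the Yang–Mills mass gap

Source: held text `paper:balaban1985-cmp97-bij-higgs-minimizers` (journal page = PDF + 298); renders of pp. 303–305 read as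
images (`pub-balaban/t4/b2b-balaban-t4-lit2/renders/bij1985/…-p005,p006-x2.png`, `HOME/lit-balaban-r15/pages/…-p007-x2.png`).
Rows C1.Eq2.6, C1.Eq2.8, C1.Eq2.9, C1.Eq2.20-2.23, C1.Eq2.24 of `HOME/lit-balaban-r15/ROWS-C1.md`.  Companion:
`BIJ85Sect2SurfaceAverages` ((2.14)–(2.19), the case "surface bonds", with its two-scale bond geometry).

## What is typed, and how

The three block averages of Sect. 2 have ONE shape: fine cells `F` (sites of T₁ / unit bonds / unit plaquettes), coarse
cells `C` (sites / bonds / plaquettes of the L-lattice), each fine cell lying in the block set `B(c)` of at most one coarse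
cell (`cell : F → Option C`; sites: every x lies in some B(y); bonds: the surface bonds B^s(b′) (2.15), interior bonds in
none; plaquettes: the edge plaquettes B^e(p′) p. 305, the others in none), and an exponent `m` with
(Qf)(c) = L^{−(d−m)} Σ_{p∈B(c)} f(p), (Q^*g)(p) = L^m g(c) for p ∈ B(c) (0 otherwise), adjoint to each other for the inner
products Σ_p f g on the unit lattice and Σ_c L^d f g on the L-lattice ((2.2), (2.14), (2.20) with a = L):
* sites, m = 0: **(2.6)** *"(Qφ)_y = L^{−d} Σ_{x∈B(y)} u(Γ_{yx})φ_x"* (with the U(1) transports u(Γ_{yx}) — `Qcov`) and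
  **(2.9)** *"QQ^* = I, where Q^* is the adjoint in the scalar product (2.2). … Furthermore Q^*Q is an orthogonal
  projection. In other words Q is a partial isometry."*;
* surface bonds, m = 1: (2.16)–(2.18) (typed in `BIJ85Sect2SurfaceAverages`; re-obtained here as the instance m = 1);
* edge plaquettes, m = 2: **(2.21)** *"(Q^ef)(p′) = L^{−(d−2)} Σ_{p∈B(p′)} f(p)"*, **(2.22)** *"(Q^{e*}f)(p) = L²f(p′) if
  p ∈ B^e(p′), 0 otherwise"*, **(2.23)** *"Q^eQ^{e*} = L²I, Q^{e*}Q^e = L²P^e, where P^e is the orthogonal projection onto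
  configurations which are constant on edge plaquettes and zero elsewhere"*;
* **(2.24)** *"Q^e_kQ^{e*}_k = L^{2k}I = η^{−2}I, Q^s_kQ^{s*}_k = L^kI = η^{−1}I"* = the same identities for the k-fold
  geometry (block size L^k: "Q_k is given by the formula (2.13), where L is replaced by L^k", p. 309).
PROVED (finite sums): Q^* IS the adjoint of Q (`inner_Q_eq_inner_Qstar`, `inner_Qcov_eq_inner_QcovStar`); QQ^* = L^m·I
under the printed count |B(c)| = L^{d−m} (`Q_Qstar`; sites |B(y)| = L^d, surface bonds L^{d−1}, edge plaquettes L^{d−2});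
Q^*Q = L^m·P with P the block-averaging operator (`Qstar_Q`), P idempotent and symmetric, i.e. an orthogonal projection
(`P_idem`, `inner_P_symm`); the covariant case (2.9) `Qcov_QcovStar`; and **(2.8)** *"An important property of the
average is that Q commutes with gauge transformations … (Qφ)^h = Qφ^h"* PROVED from the transformation law of the
transports u^h(Γ_{yx}) = h(y)u(Γ_{yx})h(x)^{−1} (taken as the hypothesis `hτ`; it is the telescoping of (2.7) along Γ_{yx})
— `Qcov_gauge`.  The lattice geometry (which cells lie in which blocks, the counts) is the instance's.
-/

open scoped BigOperators ComplexConjugate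

namespace Literature.MathematicalPhysics.QuantumFieldTheory.BalabanImbrieJaffe1984to88.BIJ85CellAverages

/-- The common two-scale cell geometry of the averages of Sect. 2 (pp. 303–305): fine cells `F`, coarse cells `C`, the
block membership `cell` (p ∈ B(c) iff `cell p = some c`; `none` = "interior bonds" / plaquettes that are not edge
plaquettes), block size `L ≥ 1`, dimension `d` and the exponent `m ≤ d` of the average ((2.6): m = 0; (2.16): m = 1;
(2.21): m = 2). [cite: BalabanImbrieJaffe1985, (2.21) p.305] -/
structure Cells where
  /-- fine cells (sites / unit bonds / unit plaquettes) -/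
  F : Type
  /-- coarse cells (L-lattice sites / bonds / plaquettes) -/
  C : Type
  [fF : Fintype F]
  [fC : Fintype C]
  [dF : DecidableEq F]
  [dC : DecidableEq C]
  /-- the coarse cell whose block set contains the fine cell, if any -/
  cell : F → Option C
  /-- block size -/
  L : ℕ
  /-- dimension -/
  d : ℕ
  /-- exponent of the average -/
  m : ℕ
  one_le_L : 1 ≤ L
  m_le_d : m ≤ d

namespace Cells

variable (G : Cells)

/-- plumbing (API for (2.6)–(2.24)): finiteness of the fine cells. [cite: BalabanImbrieJaffe1985, (2.21) p.305] -/
instance instFintypeF : Fintype G.F := G.fF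
/-- plumbing (API for (2.6)–(2.24)): finiteness of the coarse cells. [cite: BalabanImbrieJaffe1985, (2.21) p.305] -/
instance instFintypeC : Fintype G.C := G.fC
/-- plumbing (API for (2.6)–(2.24)): decidable equality of fine cells. [cite: BalabanImbrieJaffe1985, (2.21) p.305] -/
instance instDecEqF : DecidableEq G.F := G.dF
/-- plumbing (API for (2.6)–(2.24)): decidable equality of coarse cells. [cite: BalabanImbrieJaffe1985, (2.21) p.305] -/
instance instDecEqC : DecidableEq G.C := G.dC

/-- The block set B(c) of a coarse cell (B(y) (2.4); B^s(b′) (2.15); B^e(p′) p. 305: *"those unit plaquettes p which (i) are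
parallel to p′, (ii) whose bonds touch four distinct L-blocks, and (iii) such that these L-blocks contain the corners of
p′"*). [cite: BalabanImbrieJaffe1985, (2.21) p.305] -/
def B (c : G.C) : Finset G.F := Finset.univ.filter fun p => G.cell p = some c

/-- kernel: membership in B(c). [cite: BalabanImbrieJaffe1985, (2.21) p.305] -/
theorem mem_B (c : G.C) (p : G.F) : p ∈ G.B c ↔ G.cell p = some c := by simp [B]

/-- kernel: a fine cell lies in at most one block set. [cite: BalabanImbrieJaffe1985, (2.21) p.305] -/
theorem B_unique {c c' : G.C} {p : G.F} (h : p ∈ G.B c) (h' : p ∈ G.B c') : c = c' := by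
  rw [mem_B] at h h'
  exact Option.some_injective _ (h.symm.trans h')

/-! ### The real (Lie-algebra) averages: (2.16)–(2.18), (2.21)–(2.23), (2.24) -/

/-- **(2.21)** p. 305 [PDF 7] (m = 2), **(2.16)** p. 304 (m = 1), verbatim (2.21): *"The edge average Q^e is defined by
(Q^ef)(p′) = L^{−(d−2)} Σ_{p∈B(p′)} f(p). (2.21)"* — (Qf)(c) = L^{−(d−m)} Σ_{p∈B(c)} f(p).
[cite: BalabanImbrieJaffe1985, (2.21) p.305] -/
noncomputable def Q (f : G.F → ℝ) (c : G.C) : ℝ :=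
  ((G.L : ℝ) ^ (G.d - G.m))⁻¹ * ∑ p ∈ G.B c, f p

/-- **(2.22)** p. 305 [PDF 7] (m = 2), **(2.17)** p. 304 (m = 1), verbatim (2.22): *"Then (Q^{e*}f)(p) = L²f(p′), if
p ∈ B^e(p′), 0, otherwise. (2.22)"* — typed as the sum over coarse cells of the printed case expression (at most one
term non-zero, `B_unique`). [cite: BalabanImbrieJaffe1985, (2.22) p.305] -/
noncomputable def Qstar (g : G.C → ℝ) (p : G.F) : ℝ :=
  ∑ c : G.C, if p ∈ G.B c then (G.L : ℝ) ^ G.m * g c else 0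

/-- kernel, first printed case of (2.22)/(2.17): (Q^*g)(p) = L^m g(c) for p ∈ B(c). [cite: BalabanImbrieJaffe1985, (2.22) p.305] -/
theorem Qstar_of_mem (g : G.C → ℝ) {p : G.F} {c : G.C} (h : p ∈ G.B c) : G.Qstar g p = (G.L : ℝ) ^ G.m * g c := by
  classical
  unfold Qstar
  rw [Finset.sum_eq_single c]
  · simp [h]
  · intro c' _ hne
    have : p ∉ G.B c' := fun h' => hne (G.B_unique h' h)
    simp [this]
  · intro hc
    exact absurd (Finset.mem_univ c) hc

/-- kernel, second printed case of (2.22)/(2.17): (Q^*g)(p) = 0 for p in no block set. [cite: BalabanImbrieJaffe1985, (2.22) p.305] -/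
theorem Qstar_of_not_mem (g : G.C → ℝ) {p : G.F} (h : ∀ c, p ∉ G.B c) : G.Qstar g p = 0 := by
  unfold Qstar
  exact Finset.sum_eq_zero fun c _ => by simp [h c]

/-- **(2.20)** p. 305 [PDF 7], verbatim: *"The natural scalar product for functions on lattice plaquettes is ⟨f,g⟩_a = Σ_p a^d f_pg_p,
(2.20) where p is a plaquette on the a-lattice"* (likewise (2.2) for sites, (2.14) for bonds) — for a finite cell set and
spacing `a`. [cite: BalabanImbrieJaffe1985, (2.20) p.305] -/
def inner {X : Type} [Fintype X] (a : ℝ) (d : ℕ) (f g : X → ℝ) : ℝ :=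
  ∑ p : X, a ^ d * f p * g p

/-- kernel: L^d · L^{−(d−m)} = L^m for m ≤ d. [cite: BalabanImbrieJaffe1985, (2.22) p.305] -/
theorem pow_mul_inv_pow : (G.L : ℝ) ^ G.d * ((G.L : ℝ) ^ (G.d - G.m))⁻¹ = (G.L : ℝ) ^ G.m := by
  have hL : (G.L : ℝ) ≠ 0 := by have := G.one_le_L; positivity
  have hd : G.d = (G.d - G.m) + G.m := (Nat.sub_add_cancel G.m_le_d).symm
  rw [hd, pow_add, Nat.add_sub_cancel]
  field_simp

/-- kernel: (2.22)/(2.17) IS the adjoint of (2.21)/(2.16) for the inner products (2.20) with a = 1 on the unit lattice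
and a = L on the L-lattice: ⟨Qf, g⟩_L = ⟨f, Q^*g⟩₁ ("where Q^* is the adjoint in the scalar product (2.2)", p. 303).
[cite: BalabanImbrieJaffe1985, (2.22) p.305] -/
theorem inner_Q_eq_inner_Qstar (f : G.F → ℝ) (g : G.C → ℝ) :
    inner (G.L : ℝ) G.d (G.Q f) g = inner 1 G.d f (G.Qstar g) := by
  classical
  have hpow := G.pow_mul_inv_pow
  unfold inner Q Qstar
  simp only [one_pow, one_mul]
  have hL' : ∀ c : G.C, (G.L : ℝ) ^ G.d * (((G.L : ℝ) ^ (G.d - G.m))⁻¹ * ∑ p ∈ G.B c, f p) * g c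
      = ∑ p ∈ G.B c, (G.L : ℝ) ^ G.m * f p * g c := by
    intro c
    rw [← mul_assoc, hpow, Finset.mul_sum, Finset.sum_mul]
  have hR : ∀ p : G.F, f p * ∑ c : G.C, (if p ∈ G.B c then (G.L : ℝ) ^ G.m * g c else 0)
      = ∑ c : G.C, (if p ∈ G.B c then (G.L : ℝ) ^ G.m * f p * g c else 0) := by
    intro p
    rw [Finset.mul_sum]
    refine Finset.sum_congr rfl fun c _ => ?_
    split_ifs <;> ring
  simp_rw [hL', hR]
  rw [Finset.sum_comm]
  refine Finset.sum_congr rfl fun c _ => ?_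
  rw [Finset.sum_ite_mem, Finset.univ_inter]

/-- **(2.23)** first identity p. 305 [PDF 7] (m = 2), (2.18) (m = 1), (2.24) (k-fold geometry, block size L^k), verbatim
(2.23): *"Also Q^eQ^{e*} = L²I"* — QQ^* = L^m·I, PROVED under the printed count |B(c)| = L^{d−m} (an L-cube has L^{d−1}
surface bonds on a face and L^{d−2} edge plaquettes along an edge; explicit hypothesis `hcard`).
[cite: BalabanImbrieJaffe1985, (2.23) p.305] -/
theorem Q_Qstar (hcard : ∀ c : G.C, (G.B c).card = G.L ^ (G.d - G.m)) (g : G.C → ℝ) (c : G.C) :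
    G.Q (G.Qstar g) c = (G.L : ℝ) ^ G.m * g c := by
  have hpowne : ((G.L : ℝ) ^ (G.d - G.m)) ≠ 0 := by have := G.one_le_L; positivity
  unfold Q
  have h1 : ∑ p ∈ G.B c, G.Qstar g p = ∑ p ∈ G.B c, (G.L : ℝ) ^ G.m * g c :=
    Finset.sum_congr rfl fun p hp => G.Qstar_of_mem g hp
  rw [h1, Finset.sum_const, hcard, nsmul_eq_mul]
  push_cast
  rw [← mul_assoc, inv_mul_cancel₀ hpowne, one_mul]

/-- The block-averaging operator P of (2.23)/(2.18): (Pf)(p) = L^{−(d−m)} Σ_{q∈B(c)} f(q) for p ∈ B(c), 0 for p in no block set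
— *"P^e is the orthogonal projection onto configurations which are constant on edge plaquettes and zero elsewhere"* (for
the count |B(c)| = L^{d−m}, `P_idem`, `inner_P_symm`). [cite: BalabanImbrieJaffe1985, (2.23) p.305] -/
noncomputable def P (f : G.F → ℝ) (p : G.F) : ℝ :=
  ∑ c : G.C, if p ∈ G.B c then ((G.L : ℝ) ^ (G.d - G.m))⁻¹ * ∑ q ∈ G.B c, f q else 0

/-- kernel: (Pf)(p) = L^{−(d−m)} Σ_{q∈B(c)} f(q) for p ∈ B(c). [cite: BalabanImbrieJaffe1985, (2.23) p.305] -/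
theorem P_of_mem (f : G.F → ℝ) {p : G.F} {c : G.C} (h : p ∈ G.B c) :
    G.P f p = ((G.L : ℝ) ^ (G.d - G.m))⁻¹ * ∑ q ∈ G.B c, f q := by
  classical
  unfold P
  rw [Finset.sum_eq_single c]
  · simp [h]
  · intro c' _ hne
    have : p ∉ G.B c' := fun h' => hne (G.B_unique h' h)
    simp [this]
  · intro hc
    exact absurd (Finset.mem_univ c) hc

/-- kernel: (Pf)(p) = 0 for p in no block set ("zero elsewhere"). [cite: BalabanImbrieJaffe1985, (2.23) p.305] -/
theorem P_of_not_mem (f : G.F → ℝ) {p : G.F} (h : ∀ c, p ∉ G.B c) : G.P f p = 0 := by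
  unfold P
  exact Finset.sum_eq_zero fun c _ => by simp [h c]

/-- **(2.23)** second identity p. 305 [PDF 7], (2.18): *"Q^{e*}Q^e = L²P^e"* — Q^*Q = L^m·P, PROVED (definitional with `P`).
[cite: BalabanImbrieJaffe1985, (2.23) p.305] -/
theorem Qstar_Q (f : G.F → ℝ) (p : G.F) : G.Qstar (G.Q f) p = (G.L : ℝ) ^ G.m * G.P f p := by
  unfold Qstar P Q
  rw [Finset.mul_sum]
  refine Finset.sum_congr rfl fun c _ => ?_
  split_ifs <;> ring

/-- kernel: P is idempotent under the printed count |B(c)| = L^{d−m}. [cite: BalabanImbrieJaffe1985, (2.23) p.305] -/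
theorem P_idem (hcard : ∀ c : G.C, (G.B c).card = G.L ^ (G.d - G.m)) (f : G.F → ℝ) (p : G.F) :
    G.P (G.P f) p = G.P f p := by
  classical
  have hpowne : ((G.L : ℝ) ^ (G.d - G.m)) ≠ 0 := by have := G.one_le_L; positivity
  by_cases hp : ∃ c, p ∈ G.B c
  · obtain ⟨c, hc⟩ := hp
    rw [G.P_of_mem _ hc, G.P_of_mem _ hc]
    have h1 : ∑ q ∈ G.B c, G.P f q = ∑ q ∈ G.B c, ((G.L : ℝ) ^ (G.d - G.m))⁻¹ * ∑ r ∈ G.B c, f r :=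
      Finset.sum_congr rfl fun q hq => G.P_of_mem f hq
    rw [h1, Finset.sum_const, hcard, nsmul_eq_mul]
    push_cast
    rw [← mul_assoc, ← mul_assoc, mul_comm (((G.L : ℝ) ^ (G.d - G.m))⁻¹) ((G.L : ℝ) ^ (G.d - G.m)),
      mul_inv_cancel₀ hpowne, one_mul]
  · push Not at hp
    rw [G.P_of_not_mem _ hp, G.P_of_not_mem _ hp]

/-- kernel: P is symmetric for the unit-lattice inner product, hence (with `P_idem`) an orthogonal projection.
[cite: BalabanImbrieJaffe1985, (2.23) p.305] -/
theorem inner_P_symm (f g : G.F → ℝ) : inner 1 G.d (G.P f) g = inner 1 G.d f (G.P g) := by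
  classical
  unfold inner P
  simp only [one_pow, one_mul]
  have hL : ∀ p : G.F, (∑ c : G.C, if p ∈ G.B c then ((G.L : ℝ) ^ (G.d - G.m))⁻¹ * ∑ q ∈ G.B c, f q else 0) * g p
      = ∑ c : G.C, if p ∈ G.B c then ((G.L : ℝ) ^ (G.d - G.m))⁻¹ * (∑ q ∈ G.B c, f q) * g p else 0 := by
    intro p
    rw [Finset.sum_mul]
    refine Finset.sum_congr rfl fun c _ => ?_
    split_ifs <;> ring
  have hR : ∀ p : G.F, f p * (∑ c : G.C, if p ∈ G.B c then ((G.L : ℝ) ^ (G.d - G.m))⁻¹ * ∑ q ∈ G.B c, g q else 0)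
      = ∑ c : G.C, if p ∈ G.B c then ((G.L : ℝ) ^ (G.d - G.m))⁻¹ * (∑ q ∈ G.B c, g q) * f p else 0 := by
    intro p
    rw [Finset.mul_sum]
    refine Finset.sum_congr rfl fun c _ => ?_
    split_ifs <;> ring
  simp_rw [hL, hR]
  rw [Finset.sum_comm, Finset.sum_comm (s := (Finset.univ : Finset G.F))]
  refine Finset.sum_congr rfl fun c _ => ?_
  rw [Finset.sum_ite_mem, Finset.univ_inter, Finset.sum_ite_mem, Finset.univ_inter, ← Finset.mul_sum, ← Finset.mul_sum]
  ring

/-! ### The covariant scalar average (2.6), its adjoint, (2.9) and (2.8) -/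

/-- **(2.6)** p. 303 [PDF 5], verbatim: *"The average Qφ of φ is defined by (Qφ)_y = L^{−d} Σ_{x∈B(y)} u(Γ_{yx})φ_x. (2.6)"*
— with the U(1) parallel transports τ_x = u(Γ_{yx}) along the standard contours supplied as data (`τ`).
[cite: BalabanImbrieJaffe1985, (2.6) p.303] -/
noncomputable def Qcov (τ : G.F → Circle) (φ : G.F → ℂ) (y : G.C) : ℂ :=
  ((G.L : ℂ) ^ G.d)⁻¹ * ∑ x ∈ G.B y, (τ x : ℂ) * φ x

/-- The adjoint of (2.6) in the scalar products (2.2): (Q^*ψ)_x = u(Γ_{yx})^{−1}ψ_y for x ∈ B(y) (*"Q^* maps functions on the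
a-lattice into functions on the L^{−1}a lattice"*, p. 303). [cite: BalabanImbrieJaffe1985, (2.9) p.303] -/
noncomputable def QcovStar (τ : G.F → Circle) (ψ : G.C → ℂ) (x : G.F) : ℂ :=
  ∑ y : G.C, if x ∈ G.B y then ((τ x)⁻¹ : Circle) * ψ y else 0

/-- **(2.2)** p. 302 [PDF 4], verbatim: *"‖φ‖²_a = Σ_{i∈T_a} |φ_i|²a^d. (2.2)"* — the corresponding complex scalar product
Σ_x w·conj(φ_x)φ′_x with the weight `w` = a^d. [cite: BalabanImbrieJaffe1985, (2.2) p.302] -/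
def innerC {X : Type} [Fintype X] (w : ℂ) (φ φ' : X → ℂ) : ℂ :=
  ∑ x : X, w * conj (φ x) * φ' x

/-- kernel: the complex conjugate of (2.6) (conj u = u^{−1} on U(1)). [cite: BalabanImbrieJaffe1985, (2.6) p.303] -/
theorem conj_Qcov (τ : G.F → Circle) (φ : G.F → ℂ) (y : G.C) :
    conj (G.Qcov τ φ y) = ((G.L : ℂ) ^ G.d)⁻¹ * ∑ x ∈ G.B y, (((τ x)⁻¹ : Circle) : ℂ) * conj (φ x) := by
  unfold Qcov
  rw [map_mul, map_inv₀, map_pow, map_natCast, map_sum]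
  congr 1
  refine Finset.sum_congr rfl fun x _ => ?_
  rw [map_mul, Circle.coe_inv_eq_conj]

/-- kernel: `QcovStar` IS the adjoint of (2.6): ⟨Qφ, ψ⟩_L = ⟨φ, Q^*ψ⟩₁ (p. 303 "where Q^* is the adjoint in the scalar
product (2.2)"; weights L^d on the L-lattice, 1 on the unit lattice). [cite: BalabanImbrieJaffe1985, (2.9) p.303] -/
theorem inner_Qcov_eq_inner_QcovStar (τ : G.F → Circle) (φ : G.F → ℂ) (ψ : G.C → ℂ) :
    innerC ((G.L : ℂ) ^ G.d) (G.Qcov τ φ) ψ = innerC 1 φ (G.QcovStar τ ψ) := by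
  classical
  have hL0 : (G.L : ℂ) ≠ 0 := Nat.cast_ne_zero.mpr (by have := G.one_le_L; omega)
  have hL : (G.L : ℂ) ^ G.d ≠ 0 := pow_ne_zero _ hL0
  unfold innerC
  simp only [one_mul, G.conj_Qcov]
  have hL' : ∀ y : G.C, (G.L : ℂ) ^ G.d * (((G.L : ℂ) ^ G.d)⁻¹ * ∑ x ∈ G.B y, (((τ x)⁻¹ : Circle) : ℂ) * conj (φ x)) * ψ y
      = ∑ x ∈ G.B y, (((τ x)⁻¹ : Circle) : ℂ) * conj (φ x) * ψ y := by
    intro y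
    rw [← mul_assoc, mul_inv_cancel₀ hL, one_mul, Finset.sum_mul]
  have hR : ∀ x : G.F, conj (φ x) * G.QcovStar τ ψ x
      = ∑ y : G.C, (if x ∈ G.B y then (((τ x)⁻¹ : Circle) : ℂ) * conj (φ x) * ψ y else 0) := by
    intro x
    unfold QcovStar
    rw [Finset.mul_sum]
    refine Finset.sum_congr rfl fun y _ => ?_
    split_ifs <;> ring
  simp_rw [hL', hR]
  rw [Finset.sum_comm]
  refine Finset.sum_congr rfl fun y _ => ?_
  rw [Finset.sum_ite_mem, Finset.univ_inter]

/-- **(2.9)** p. 303 [PDF 5], verbatim: *"A further property of Q is that QQ^* = I, (2.9) where Q^* is the adjoint in the scalar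
product (2.2)."* — PROVED for (2.6) with U(1) transports, under the count |B(y)| = L^d.
[cite: BalabanImbrieJaffe1985, (2.9) p.303] -/
theorem Qcov_QcovStar (hcard : ∀ y : G.C, (G.B y).card = G.L ^ G.d) (τ : G.F → Circle) (ψ : G.C → ℂ) (y : G.C) :
    G.Qcov τ (G.QcovStar τ ψ) y = ψ y := by
  classical
  have hL : (G.L : ℂ) ^ G.d ≠ 0 :=
    pow_ne_zero _ (Nat.cast_ne_zero.mpr (by have := G.one_le_L; omega))
  unfold Qcov
  have h1 : ∑ x ∈ G.B y, (τ x : ℂ) * G.QcovStar τ ψ x = ∑ x ∈ G.B y, ψ y := by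
    refine Finset.sum_congr rfl fun x hx => ?_
    have : G.QcovStar τ ψ x = (((τ x)⁻¹ : Circle) : ℂ) * ψ y := by
      unfold QcovStar
      rw [Finset.sum_eq_single y]
      · simp [hx]
      · intro y' _ hne
        have : x ∉ G.B y' := fun h' => hne (G.B_unique h' hx)
        simp [this]
      · intro hy
        exact absurd (Finset.mem_univ y) hy
    rw [this, ← mul_assoc, Circle.coe_inv, mul_inv_cancel₀ (Circle.coe_ne_zero _), one_mul]
  rw [h1, Finset.sum_const, hcard, nsmul_eq_mul]
  push_cast
  rw [← mul_assoc, inv_mul_cancel₀ hL, one_mul]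

/-- **(2.8)** p. 303 [PDF 5], verbatim: *"An important property of the average is that Q commutes with gauge transformations. In
other words, let h denote a map from the unit lattice to U(1). Then h defines the gauge transformation φ_y → h(y)φ_y ≡ φ^h_y,
u_b → h(b₋)h(b₊)^{−1}u_b = u^h_b. (2.7) Clearly (Qφ)^h = Qφ^h. (2.8)"* — PROVED from the transformation law of the transports
under (2.7), u^h(Γ_{yx}) = h(y)u(Γ_{yx})h(x)^{−1} for x ∈ B(y) (hypothesis `hτ`, the telescoping of (2.7) along Γ_{yx};
`hC y` = h at the corner y). [cite: BalabanImbrieJaffe1985, (2.8) p.303] -/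
theorem Qcov_gauge (τ τh : G.F → Circle) (h : G.F → Circle) (hC : G.C → Circle)
    (hτ : ∀ (y : G.C) (x : G.F), x ∈ G.B y → τh x = hC y * τ x * (h x)⁻¹) (φ : G.F → ℂ) (y : G.C) :
    G.Qcov τh (fun x => (h x : ℂ) * φ x) y = (hC y : ℂ) * G.Qcov τ φ y := by
  unfold Qcov
  have h1 : ∑ x ∈ G.B y, (τh x : ℂ) * ((h x : ℂ) * φ x) = ∑ x ∈ G.B y, (hC y : ℂ) * ((τ x : ℂ) * φ x) := by
    refine Finset.sum_congr rfl fun x hx => ?_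
    rw [hτ y x hx]
    push_cast
    field_simp
  rw [h1, ← Finset.mul_sum]
  ring

end Cells

end Literature.MathematicalPhysics.QuantumFieldTheory.BalabanImbrieJaffe1984to88.BIJ85CellAverages
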